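import Summits.KontsevichZagierPeriods.KontsevichZagierPeriods.Theorems.CubeKernelStep.Negative.SecondWindow
import Summits.KontsevichZagierPeriods.KontsevichZagierPeriods.Theorems.CompleteModGammaSector.Negative.FirstCoordinateCdf
import Literature.Barriers.KontsevichZagierPeriods.AlgebraicPrimitivesObstruction
import Literature.NumberTheory.Transcendental.KZCubicalCalculus
import Summits.KontsevichZagierPeriods.KontsevichZagierPeriods.Theorems.EllipticMomentKernel.Negative.VerticalBand

/-!
# `CubeKernelStep` (stmt-KontsevichZagierPeriods-17854) — negative side IV: the step needs rule (2)

cdisprove (refuter) negative lemma for the crux `CubeKernelStep` of route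
`KontsevichZagierPeriods/UnfoldedStokes`:

  **`cubeKernelStep_false_without_changeOfVariables`** — the statement of the crux with
  `KZ.relations` replaced by `rulesOneThreeLow = closure ((1a) ∪ (1b) ∪ (3) ∪ {[r] : dim r ≤ 1})`
  is FALSE, at its first instance `d = 1`: the interval layer (indeed everything of dimension `≤ 1`)
  is granted, yet the continuous square kernel element

  `sqRep = [[0,1]², 1/(1+x) − s/(2 − sx) − s/(1 + sx)]`   (coordinates `(s, x)`; value `0`)

  is not generated. So ANY proof of the step `1 → 2` uses change of variables IN DIMENSION `≥ 2`
  (not merely inside the hypothesis layer), and Newton–Leibniz along ONE coordinate direction plus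
  additivity is incomplete on the square: derivatives along a second direction enter only through a
  coordinate permutation, i.e. rule (2) (cf. the fibrewise-Stokes calibration of the parent line,
  which permutes `i` last).

Mechanism (`Negative/SecondWindow.lean`): along `rulesOneThreeLow` the second-layer window values
`e ↦ Λ²ₑ` have a `ℚ`-semialgebraic derivative off a finite set; for `sqRep` that derivative is the
PERIOD FUNCTION `V(s) = ∫₀¹ h(s,x) dx = log (2 − s) − log (1 + s)` (fibrewise Newton–Leibniz with the
primitive `log (1+x) + log (2 − sx) − log (1 + sx)`, tree `setIntegral_band_restrict`, then a clamped
primitive in `s`), and `((s − 2)(s + 1))·V′ = 3`: a function with such a derivative satisfies no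
polynomial identity `P(s, V s) = 0` (tree descent `NoSemialgPrimKernel.eq_zero_of_evalEval_eq_zero`),
whereas a `ℚ`-semialgebraic function of one variable does. NON-VACUITY: `sqRep ∈ ker eval`
(`sqRep_mem_ker_eval`); in the full calculus it is three moves away from `0` (cut along the diagonal,
swap the halves by rule (2), add) — it refutes only the rule-(2)-free strengthening, as it must
(`Negative/Calibration.lean`: a refutation of the crux itself would refute the summit).

[Kontsevich–Zagier 2001, §1.2; Ayoub 2015, Rem. 1.2, 1.5; Fresán 2024, Rem. 3.6–3.7; van den Dries 1998, Ch. 3 (1.2)]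
-/

noncomputable section

namespace Summit.KontsevichZagierPeriods.UnfoldedStokes.CubeKernelStepNegative

open MeasureTheory Set Filter Topology
open Literature.NumberTheory.Transcendental
open Literature.NumberTheory.Transcendental.KZ
open Literature.ModelTheory.ExponentialFields (IsSemialgebraic)
open Summit.KontsevichZagierPeriods.PlanarAreas.Negative (win mem_win_succ setIntegral_clamp)
open Summit.KontsevichZagierPeriods.CompleteModGammaSectorNegative (setIntegral_band_restrict fin_one_eq)
open Literature.Barriers.KontsevichZagierPeriods.KZ (NoSemialgPrim.exists_ne_zero_isOpen
  NoSemialgPrim.evalEval_equivMvPolynomial_symm NoSemialgPrimKernel.eq_zero_of_evalEval_eq_zero)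
open Summit.KontsevichZagierPeriods.HermiteRigidity.EllipticMomentKernelNegative (snoc₂_apply_zero snoc₂_apply_one)

/-! ### The witness `[[0,1]², 1/(1+x) − s/(2 − sx) − s/(1 + sx)]` -/

/-- The square integrand `h(s,x) = 1/(1+x) − s/(2 − sx) − s/(1 + sx)` (`s = z 0`, `x = z 1`): rational
over `ℚ`, poles off the closed square. -/
def sqFun (z : Fin 2 → ℝ) : ℝ := 1 / (1 + z 1) - z 0 / (2 - z 0 * z 1) - z 0 / (1 + z 0 * z 1)

/-- The three denominators are positive for `s, x ∈ [0,1]`. [folklore] -/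
theorem denom_pos {s x : ℝ} (hs : s ∈ Icc (0:ℝ) 1) (hx : x ∈ Icc (0:ℝ) 1) :
    0 < 1 + x ∧ 0 < 2 - s * x ∧ 0 < 1 + s * x := by
  refine ⟨by linarith [hx.1], ?_, ?_⟩
  · nlinarith [hs.1, hs.2, hx.1, hx.2]
  · nlinarith [hs.1, hx.1]

/-- Coordinates of a point of the closed square lie in `[0,1]`. [folklore] -/
theorem apply_mem_Icc_of_mem_cube₂ {z : Fin 2 → ℝ} (hz : z ∈ cube 2) (i : Fin 2) : z i ∈ Icc (0:ℝ) 1 :=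
  ⟨(hz i).1, (hz i).2⟩

/-- The square integrand is analytic near the closed square. [folklore] -/
theorem sqFun_analyticOnNhd : AnalyticOnNhd ℝ sqFun (cube 2) := by
  intro z hz
  have h0 : AnalyticAt ℝ (fun y : Fin 2 → ℝ => y 0) z :=
    (ContinuousLinearMap.proj (R := ℝ) (φ := fun _ : Fin 2 => ℝ) 0).analyticAt z
  have h1 : AnalyticAt ℝ (fun y : Fin 2 → ℝ => y 1) z :=
    (ContinuousLinearMap.proj (R := ℝ) (φ := fun _ : Fin 2 => ℝ) 1).analyticAt z
  obtain ⟨hA, hB, hC⟩ := denom_pos (apply_mem_Icc_of_mem_cube₂ hz 0) (apply_mem_Icc_of_mem_cube₂ hz 1)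
  exact ((analyticAt_const.div (analyticAt_const.add h1) hA.ne').sub
    (h0.div (analyticAt_const.sub (h0.mul h1)) hB.ne')).sub (h0.div (analyticAt_const.add (h0.mul h1)) hC.ne')

/-- The square integrand is `ℚ`-semialgebraic on the square (a quotient of `ℚ`-polynomials).
[cite: KontsevichZagier2001, §1.1] -/
theorem sqFun_isSemialgebraicFunOn : IsSemialgebraicFunOn ℚ (cube 2) sqFun := by
  have hq : ∀ z ∈ cube 2, MvPolynomial.aeval z
      ((MvPolynomial.C 1 + MvPolynomial.X 1) * (MvPolynomial.C 2 - MvPolynomial.X 0 * MvPolynomial.X 1) *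
        (MvPolynomial.C 1 + MvPolynomial.X 0 * MvPolynomial.X 1) : MvPolynomial (Fin 2) ℚ) ≠ 0 := by
    intro z hz
    obtain ⟨hA, hB, hC⟩ := denom_pos (apply_mem_Icc_of_mem_cube₂ hz 0) (apply_mem_Icc_of_mem_cube₂ hz 1)
    simp only [map_mul, map_add, map_sub, MvPolynomial.aeval_C, MvPolynomial.aeval_X, eq_ratCast,
      Rat.cast_ofNat, Rat.cast_one]
    exact mul_ne_zero (mul_ne_zero hA.ne' hB.ne') hC.ne'
  refine (isSemialgebraicFunOn_aeval_div_aeval (k := ℚ) (R := ℝ) isSemialgebraic_cube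
    ((MvPolynomial.C 2 - MvPolynomial.X 0 * MvPolynomial.X 1) * (MvPolynomial.C 1 + MvPolynomial.X 0 * MvPolynomial.X 1) -
      MvPolynomial.X 0 * (MvPolynomial.C 1 + MvPolynomial.X 1) * (MvPolynomial.C 1 + MvPolynomial.X 0 * MvPolynomial.X 1) -
      MvPolynomial.X 0 * (MvPolynomial.C 1 + MvPolynomial.X 1) * (MvPolynomial.C 2 - MvPolynomial.X 0 * MvPolynomial.X 1) :
        MvPolynomial (Fin 2) ℚ)
    ((MvPolynomial.C 1 + MvPolynomial.X 1) * (MvPolynomial.C 2 - MvPolynomial.X 0 * MvPolynomial.X 1) *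
      (MvPolynomial.C 1 + MvPolynomial.X 0 * MvPolynomial.X 1)) hq).congr ?_
  intro z hz
  obtain ⟨hA, hB, hC⟩ := denom_pos (apply_mem_Icc_of_mem_cube₂ hz 0) (apply_mem_Icc_of_mem_cube₂ hz 1)
  simp only [map_mul, map_add, map_sub, MvPolynomial.aeval_C, MvPolynomial.aeval_X, eq_ratCast,
    Rat.cast_ofNat, Rat.cast_one, sqFun]
  rw [div_sub_div _ _ hA.ne' hB.ne', div_sub_div _ _ (mul_ne_zero hA.ne' hB.ne') hC.ne',
    div_eq_div_iff (mul_ne_zero (mul_ne_zero hA.ne' hB.ne') hC.ne')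
      (mul_ne_zero (mul_ne_zero hA.ne' hB.ne') hC.ne')]
  ring

/-- **The witness** `sqRep = [[0,1]², h]`, a continuous closed-square representation of KZ's literal
shape. -/
def sqRep : IntegralRep 2 := IntegralRep.tameCube sqFun sqFun_analyticOnNhd sqFun_isSemialgebraicFunOn

/-- Its domain, in the product form of the crux. [folklore] -/
theorem sqRep_domain : sqRep.domain = Set.pi Set.univ (fun _ : Fin 2 => Set.Icc (0:ℝ) 1) := cube_eq_pi 2
/-- Its integrand is continuous on the CLOSED square. [folklore] -/
theorem sqRep_continuousOn : ContinuousOn sqRep.integrand sqRep.domain := sqFun_analyticOnNhd.continuousOn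

/-- The auxiliary base representation `[[0,1], 0]` (only its domain is used). -/
def baseRep₁ : IntegralRep 1 :=
  IntegralRep.tameCube (fun _ => (0:ℝ)) (fun _ _ => analyticAt_const)
    ((isSemialgebraicFunOn_natCast isSemialgebraic_cube 0).congr fun _ _ => by simp)

/-! ### Fibre primitive, period function, and the second-layer window values of the witness -/

/-- The fibre primitive `H(s,x) = log (1+x) + log (2 − sx) − log (1 + sx)` (`∂ₓH = h`; `ℚ`-semialgebraic
it is not, and need not be: it only computes a value). -/
def sqPrim (z : Fin 2 → ℝ) : ℝ := Real.log (1 + z 1) + Real.log (2 - z 0 * z 1) - Real.log (1 + z 0 * z 1)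

/-- The period function `V(s) = ∫₀¹ h(s,x) dx = log (2 − s) − log (1 + s)`. -/
def periodFun (s : ℝ) : ℝ := Real.log (2 - s) - Real.log (1 + s)
/-- A primitive of the period function: `W(s) = −(2−s) log (2−s) − (1+s) log (1+s)`. -/
def periodPrim (s : ℝ) : ℝ := -((2 - s) * Real.log (2 - s)) - (1 + s) * Real.log (1 + s)

/-- **Fibrewise Newton–Leibniz data**: `∂ₓ H(s,·) = h(s,·)` on `[0,1]` for `s ∈ [0,1]`. [folklore] -/
theorem hasDerivAt_sqPrim {y : Fin 1 → ℝ} (hy : y 0 ∈ Icc (0:ℝ) 1) {t : ℝ} (ht : t ∈ Icc (0:ℝ) 1) :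
    HasDerivAt (fun u : ℝ => sqPrim (Fin.snoc y u)) (sqFun (Fin.snoc y t)) t := by
  simp only [sqPrim, sqFun, snoc₂_apply_zero, snoc₂_apply_one]
  obtain ⟨hA, hB, hC⟩ := denom_pos hy ht
  have h1 : HasDerivAt (fun u : ℝ => Real.log (1 + u)) (1 / (1 + t)) t :=
    ((hasDerivAt_id t).const_add 1).log hA.ne'
  have h2 : HasDerivAt (fun u : ℝ => Real.log (2 - y 0 * u)) ((-(y 0 * 1)) / (2 - y 0 * t)) t :=
    (((hasDerivAt_id t).const_mul (y 0)).const_sub 2).log hB.ne'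
  have h3 : HasDerivAt (fun u : ℝ => Real.log (1 + y 0 * u)) ((y 0 * 1) / (1 + y 0 * t)) t :=
    (((hasDerivAt_id t).const_mul (y 0)).const_add 1).log hC.ne'
  refine ((h1.add h2).sub h3).congr_deriv ?_
  ring

/-- `W' = V` on `[0,1]`. [folklore] -/
theorem hasDerivAt_periodPrim {s : ℝ} (hs : s ∈ Icc (0:ℝ) 1) : HasDerivAt periodPrim (periodFun s) s := by
  have h2 : (2:ℝ) - s ≠ 0 := by linarith [hs.2]
  have h1 : (1:ℝ) + s ≠ 0 := by linarith [hs.1]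
  have hA : HasDerivAt (fun u : ℝ => (2 - u) * Real.log (2 - u))
      ((-1) * Real.log (2 - s) + (2 - s) * ((-1) / (2 - s))) s :=
    ((hasDerivAt_id s).const_sub 2).mul (((hasDerivAt_id s).const_sub 2).log h2)
  have hB : HasDerivAt (fun u : ℝ => (1 + u) * Real.log (1 + u))
      (1 * Real.log (1 + s) + (1 + s) * (1 / (1 + s))) s :=
    ((hasDerivAt_id s).const_add 1).mul (((hasDerivAt_id s).const_add 1).log h1)
  refine (hA.neg.sub hB).congr_deriv ?_
  unfold periodFun
  field_simp
  ring

/-- `V' = −1/(2−s) − 1/(1+s)` on `(0,1)`. [folklore] -/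
theorem hasDerivAt_periodFun {s : ℝ} (hs : s ∈ Ioo (0:ℝ) 1) :
    HasDerivAt periodFun ((-1) / (2 - s) - 1 / (1 + s)) s :=
  (((hasDerivAt_id s).const_sub 2).log (show (2:ℝ) - s ≠ 0 by linarith [hs.2])).sub
    (((hasDerivAt_id s).const_add 1).log (show (1:ℝ) + s ≠ 0 by linarith [hs.1]))

/-- `V` is continuous on `[0,1]`. [folklore] -/
theorem continuousOn_periodFun : ContinuousOn periodFun (Icc 0 1) := by
  refine ContinuousOn.sub ?_ ?_
  · exact (continuousOn_const.sub continuousOn_id).log fun s hs => by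
      show (2:ℝ) - s ≠ 0
      linarith [hs.2]
  · exact (continuousOn_const.add continuousOn_id).log fun s hs => by
      show (1:ℝ) + s ≠ 0
      linarith [hs.1]

/-- `W` is continuous on `[0,1]`. [folklore] -/
theorem continuousOn_periodPrim : ContinuousOn periodPrim (Icc 0 1) :=
  fun _ hs => (hasDerivAt_periodPrim hs).continuousAt.continuousWithinAt

/-- **Fubini + fibrewise FTC**: the second-layer window value of the witness is the windowed integral
of its period function. [cite: KontsevichZagier2001, §1.2 rule (3)] -/
theorem restrictedEval_win₂_sqRep_eq (e : ℝ) :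
    restrictedEval (win₂ e) (of sqRep) = ∫ y in cube 1 ∩ {y : Fin 1 → ℝ | y 0 < e}, periodFun (y 0) := by
  rw [restrictedEval_win₂_of_add_two (n := 0), restrictedEval_of]
  have hS : MeasurableSet {y : Fin 1 → ℝ | y 0 < e} :=
    measurableSet_lt (measurable_pi_apply 0) measurable_const
  have hset : sqRep.domain ∩ win e (0 + 1 + 1) = sqRep.domain ∩ {z | Fin.init z ∈ {y : Fin 1 → ℝ | y 0 < e}} := by
    ext z
    simp only [mem_inter_iff, mem_setOf_eq, mem_win_succ]
    exact Iff.rfl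
  rw [hset]
  have hdom : sqRep.domain = {z | (Fin.init z : Fin 1 → ℝ) ∈ baseRep₁.domain ∧
      (fun _ : Fin 1 → ℝ => (0:ℝ)) (Fin.init z) ≤ z (Fin.last 1) ∧
      z (Fin.last 1) ≤ (fun _ : Fin 1 → ℝ => (1:ℝ)) (Fin.init z)} := cube_succ_eq 1
  have hcont : ∀ y ∈ baseRep₁.domain, ContinuousOn (fun t : ℝ => sqPrim (Fin.snoc y t))
      (Icc ((fun _ : Fin 1 → ℝ => (0:ℝ)) y) ((fun _ : Fin 1 → ℝ => (1:ℝ)) y)) := fun y hy t ht =>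
    (hasDerivAt_sqPrim ⟨(hy 0).1, (hy 0).2⟩ ht).continuousAt.continuousWithinAt
  have hderiv : ∀ y ∈ baseRep₁.domain, ∀ t ∈ Ioo ((fun _ : Fin 1 → ℝ => (0:ℝ)) y) ((fun _ : Fin 1 → ℝ => (1:ℝ)) y),
      HasDerivAt (fun u : ℝ => sqPrim (Fin.snoc y u)) (sqRep.integrand (Fin.snoc y t)) t :=
    fun y hy t ht => hasDerivAt_sqPrim ⟨(hy 0).1, (hy 0).2⟩ (Ioo_subset_Icc_self ht)
  rw [setIntegral_band_restrict (n := 1) sqRep baseRep₁ (fun _ _ => zero_le_one) hdom hcont hderiv hS]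
  refine setIntegral_congr_fun (measurableSet_cube.inter hS) fun y _ => ?_
  simp only [sqPrim, periodFun, snoc₂_apply_zero, snoc₂_apply_one, mul_one, mul_zero, add_zero, sub_zero,
    Real.log_one]
  norm_num
  ring

/-- `V` is integrable on `[0,1]`. [folklore] -/
theorem integrableOn_periodFun : IntegrableOn periodFun (Icc 0 1) := continuousOn_periodFun.integrableOn_Icc

/-- **Second-layer window values of the witness**: the clamped transcendental primitive
`W (clamp e) − W 0`. [folklore] -/
theorem restrictedEval_win₂_sqRep (e : ℝ) :
    restrictedEval (win₂ e) (of sqRep) = periodPrim (max 0 (min e 1)) - periodPrim 0 := by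
  rw [restrictedEval_win₂_sqRep_eq]
  set E := MeasurableEquiv.funUnique (Fin 1) ℝ with hE
  have hE_apply : ∀ z : Fin 1 → ℝ, E z = z 0 := fun z => rfl
  have hmp : MeasurePreserving E volume volume := volume_preserving_funUnique (Fin 1) ℝ
  have hset : cube 1 ∩ {y : Fin 1 → ℝ | y 0 < e} = E ⁻¹' {t | 0 ≤ t ∧ t ≤ 1 ∧ t < e} := by
    ext x
    simp only [mem_inter_iff, mem_cube, Fin.forall_fin_one, mem_preimage, mem_setOf_eq, hE_apply,
      and_assoc]
  rw [hset]
  change ∫ x in E ⁻¹' {t | 0 ≤ t ∧ t ≤ 1 ∧ t < e}, periodFun (E x) = _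
  rw [hmp.setIntegral_preimage_emb E.measurableEmbedding periodFun {t | 0 ≤ t ∧ t ≤ 1 ∧ t < e}]
  exact setIntegral_clamp zero_le_one continuousOn_periodPrim
    (fun t ht => hasDerivAt_periodPrim (Ioo_subset_Icc_self ht)) integrableOn_periodFun e

/-- **The witness is a kernel element**: `∫_{[0,1]²} h = W 1 − W 0 = 0`. [folklore] -/
theorem value_sqRep : sqRep.value = 0 := by
  have h := restrictedEval_win₂_sqRep 2
  rw [restrictedEval_win₂_of_add_two (n := 0), restrictedEval_of] at h
  have hset : sqRep.domain ∩ win 2 (0 + 1 + 1) = sqRep.domain := inter_eq_left.mpr fun z hz => by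
    show z 0 < 2
    linarith [(hz 0).2]
  rw [hset] at h
  rw [IntegralRep.value, h]
  norm_num [periodPrim]

/-- NON-VACUITY: the witness lies in `ker eval` (so it refutes only the rule-(2)-free strengthening;
in the full calculus it is a relation by a diagonal cut and a swap). [folklore] -/
theorem sqRep_mem_ker_eval : of sqRep ∈ eval.ker := by
  rw [AddMonoidHom.mem_ker, eval_of, value_sqRep]

/-- On `(0,1)` the second-layer window value of the witness has derivative the period function.
[folklore] -/
theorem hasDerivAt_restrictedEval_win₂_sqRep {e : ℝ} (he : e ∈ Ioo (0:ℝ) 1) :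
    HasDerivAt (fun u => restrictedEval (win₂ u) (of sqRep)) (periodFun e) e := by
  have hEq : (fun u => restrictedEval (win₂ u) (of sqRep)) =ᶠ[𝓝 e] fun u => periodPrim u - periodPrim 0 := by
    filter_upwards [Ioo_mem_nhds he.1 he.2] with u hu
    rw [restrictedEval_win₂_sqRep, min_eq_left hu.2.le, max_eq_right hu.1.le]
  refine HasDerivAt.congr_of_eventuallyEq ?_ hEq
  exact (hasDerivAt_periodPrim (Ioo_subset_Icc_self he)).sub_const _

/-! ### Endgame: the period function is not semialgebraic, even off a finite set -/

open Polynomial in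
open scoped Polynomial.Bivariate in
/-- Steps (A)+(B) of the tree's barrier on the OPEN window: a `ℚ`-semialgebraic function of one
variable on `(0,1)` satisfies a non-trivial real polynomial identity there. [cite: BasuPollackRoy2006, Prop. 2.86] -/
theorem exists_ne_zero_evalEval_eq_zero_Ioo {F : (Fin 1 → ℝ) → ℝ}
    (hF : IsSemialgebraicFunOn ℚ openWindow F) :
    ∃ P : ℝ[X][Y], P ≠ 0 ∧ ∀ t ∈ Ioo (0 : ℝ) 1, P.evalEval t (F fun _ => t) = 0 := by
  set Γ : Set (Fin 2 → ℝ) := {z | ∃ x ∈ openWindow, z = Fin.snoc x (F x)} with hΓ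
  have hΓ' : IsSemialgebraic ℚ Γ := hF
  obtain ⟨q, hq0, hopen, -⟩ := NoSemialgPrim.exists_ne_zero_isOpen hΓ'
  have hvan : ∀ z ∈ Γ, MvPolynomial.eval z q = 0 := by
    intro z hz
    by_contra hne
    obtain ⟨ε, hε, hball⟩ := Metric.isOpen_iff.mp hopen z ⟨hz, hne⟩
    obtain ⟨x, hx, rfl⟩ := hz
    have hmem : (Fin.snoc x (F x + ε / 2) : Fin 2 → ℝ) ∈
        Metric.ball (Fin.snoc x (F x) : Fin 2 → ℝ) ε := by
      rw [Metric.mem_ball, dist_pi_lt_iff hε]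
      intro i
      fin_cases i
      · simp [Fin.snoc, hε]
      · simp [Fin.snoc, abs_of_pos hε, half_lt_self hε]
    obtain ⟨⟨x', -, hxx'⟩, -⟩ := hball hmem
    have h0 : x = x' := by
      funext j
      fin_cases j
      simpa [Fin.snoc] using congrFun hxx' 0
    have h1 := congrFun hxx' 1
    simp only [Fin.snoc] at h1
    simp [← h0] at h1
    exact absurd h1 hε.ne'
  refine ⟨(Polynomial.Bivariate.equivMvPolynomial ℝ).symm q, by simpa using hq0, ?_⟩
  intro t ht
  have hz : (Fin.snoc (fun _ : Fin 1 => t) (F fun _ => t) : Fin 2 → ℝ) ∈ Γ :=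
    ⟨fun _ => t, ht, rfl⟩
  have h := hvan _ hz
  rw [← NoSemialgPrim.evalEval_equivMvPolynomial_symm] at h
  simpa [Fin.snoc] using h

open Polynomial in
open scoped Polynomial.Bivariate in
/-- `t ↦ P(t, G t)` is continuous where `G` is. [folklore] -/
theorem continuousOn_evalEval (P : ℝ[X][Y]) {G : ℝ → ℝ} {S : Set ℝ} (hG : ContinuousOn G S) :
    ContinuousOn (fun t => P.evalEval t (G t)) S := by
  have hfP : ∀ s, P.evalEval s (G s) =
      ∑ j ∈ Finset.range (P.natDegree + 1), (P.coeff j).eval s * G s ^ j := by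
    intro s
    conv_lhs => rw [P.as_sum_range_C_mul_X_pow]
    simp [evalEval_finsetSum, evalEval_C]
  simp_rw [hfP]
  exact continuousOn_finsetSum _ fun j _ => ((P.coeff j).continuous.continuousOn).mul (hG.pow j)

open Polynomial in
open scoped Polynomial.Bivariate in
/-- **THE SEPARATION.** `[sqRep] ∉ rulesOneThreeLow`: along the enlarged rule-(2)-free sub-calculus
the second-layer window values have a `ℚ`-semialgebraic derivative `g` off a finite set
(`hasSADeriv_of_mem`); here that derivative is the period function `V = log ((2−s)/(1+s))`, so
`P(s, V s) = 0` off a finite set for some `P ≠ 0`, hence on `(0,1)` by continuity — impossible since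
`((s−2)(s+1)) V′ = 3` (simple pole with non-zero residue: `NoSemialgPrimKernel.eq_zero_of_evalEval_eq_zero`).
[cite: Ayoub2015, Rem. 1.2] [cite: Fresan2024, Rem. 3.6] -/
theorem sqRep_not_mem_rulesOneThreeLow : of sqRep ∉ rulesOneThreeLow := by
  intro hmem
  obtain ⟨s, g, hg, hd⟩ := hasSADeriv_of_mem hmem
  have hgV : ∀ e ∈ Ioo (0:ℝ) 1, e ∉ s → g e = periodFun e := fun e he hes =>
    (hd e he hes).unique (hasDerivAt_restrictedEval_win₂_sqRep he)
  obtain ⟨P, hP0, hPg⟩ := exists_ne_zero_evalEval_eq_zero_Ioo hg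
  have hcont : ContinuousOn (fun t => P.evalEval t (periodFun t)) (Ioo 0 1) :=
    continuousOn_evalEval P (continuousOn_periodFun.mono Ioo_subset_Icc_self)
  have hPV : ∀ t ∈ Ioo (0:ℝ) 1, P.evalEval t (periodFun t) = 0 := by
    intro t ht
    by_contra hne
    have hct : ContinuousAt (fun t => P.evalEval t (periodFun t)) t :=
      hcont.continuousAt (Ioo_mem_nhds ht.1 ht.2)
    have hev : ∀ᶠ u in 𝓝 t, P.evalEval u (periodFun u) ≠ 0 ∧ u ∈ Ioo (0:ℝ) 1 :=
      (hct.eventually_ne hne).and (Ioo_mem_nhds ht.1 ht.2)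
    obtain ⟨ε, hε, hball⟩ := Metric.eventually_nhds_iff.mp hev
    have hinf : (Ioo (t - ε / 2) (t + ε / 2)).Infinite := Ioo_infinite (by linarith)
    obtain ⟨u, hu, hus⟩ := hinf.exists_notMem_finset s
    have hdist : dist u t < ε := by
      rw [Real.dist_eq, abs_lt]
      constructor <;> linarith [hu.1, hu.2]
    obtain ⟨hne', hu01⟩ := hball hdist
    exact hne' (by rw [← hgV u hu01 hus]; exact hPg u hu01)
  have hV1 : (X + C (1:ℝ) : ℝ[X]).eval 2 ≠ 0 := by norm_num
  have hN : (C (3:ℝ) : ℝ[X]).eval 2 ≠ 0 := by norm_num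
  have hDN : ∀ t ∈ Ioo (0:ℝ) 1,
      ((X - C (2:ℝ)) * (X + C 1) : ℝ[X]).eval t * ((-1) / (2 - t) - 1 / (1 + t)) = (C (3:ℝ) : ℝ[X]).eval t := by
    intro t ht
    have h2 : (2:ℝ) - t ≠ 0 := by linarith [ht.2]
    have h1 : (1:ℝ) + t ≠ 0 := by linarith [ht.1]
    rw [Polynomial.eval_mul, Polynomial.eval_sub, Polynomial.eval_add, Polynomial.eval_X, Polynomial.eval_C,
      Polynomial.eval_C, Polynomial.eval_C]
    field_simp
    ring
  exact hP0 (NoSemialgPrimKernel.eq_zero_of_evalEval_eq_zero (fun t ht => hasDerivAt_periodFun ht)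
    hDN hV1 hN P.natDegree P le_rfl hPV)

/-! ### The step fails without rule (2) -/

/-- Every layer `≤ 1` of the cube kernel is granted in the enlarged sub-calculus (trivially: all of
dimension `≤ 1` is). [folklore] -/
theorem layer_le_one_rulesOneThreeLow {M : ℕ} (hM : M ≤ 1) :
    ∀ t : IntegralRep M, t.domain = Set.pi Set.univ (fun _ : Fin M => Set.Icc (0:ℝ) 1) →
      ContinuousOn t.integrand t.domain → t.value = 0 → of t ∈ rulesOneThreeLow :=
  fun t _ _ _ => of_mem_rulesOneThreeLow_of_le_one hM t

/-- **`CubeKernelStep` IS FALSE WITHOUT CHANGE OF VARIABLES**, even when every representation of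
dimension `≤ 1` is declared a relation: its first instance `d = 1` fails on `sqRep`. Any proof of the
step `1 → 2` uses rule (2) in dimension `≥ 2`; additivity + Newton–Leibniz along one coordinate
direction do not generate the continuous square kernel over the interval layer.
[cite: KontsevichZagier2001, §1.2] [cite: Ayoub2015, Rem. 1.2] -/
theorem cubeKernelStep_false_without_changeOfVariables :
    ¬ ∀ d : ℕ, 1 ≤ d →
        (∀ M : ℕ, M ≤ d → ∀ t : IntegralRep M,
          t.domain = Set.pi Set.univ (fun _ : Fin M => Set.Icc (0:ℝ) 1) →
            ContinuousOn t.integrand t.domain → t.value = 0 → of t ∈ rulesOneThreeLow) →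
        ∀ t : IntegralRep (d + 1), t.domain = Set.pi Set.univ (fun _ : Fin (d + 1) => Set.Icc (0:ℝ) 1) →
          ContinuousOn t.integrand t.domain → t.value = 0 → of t ∈ rulesOneThreeLow := fun h =>
  sqRep_not_mem_rulesOneThreeLow
    (h 1 le_rfl (fun _ hM => layer_le_one_rulesOneThreeLow hM) sqRep sqRep_domain sqRep_continuousOn
      value_sqRep)

/-- **Reading for the lines.** A continuous closed-square representation reachable by additivity and
Newton–Leibniz (through any dimensions) over EVERYTHING of dimension `≤ 1` has a first-marginal
distribution function `e ↦ ∫_{domain ∩ {s<e}} h` with a `ℚ`-semialgebraic derivative off a finite set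
— its period function `V(s) = ∫₀¹ h(s,x) dx` is then semialgebraic off finitely many points.
[cite: KontsevichZagier2001, §1.2] -/
theorem hasSADeriv_marginal_of_mem {t : IntegralRep 2} (h : of t ∈ rulesOneThreeLow) :
    HasSADeriv (fun e => ∫ z in t.domain ∩ {z : Fin 2 → ℝ | z 0 < e}, t.integrand z) := by
  have h' := hasSADeriv_of_mem h
  simp only [restrictedEval_win₂_of_add_two (n := 0), restrictedEval_of] at h'
  exact h'

end Summit.KontsevichZagierPeriods.UnfoldedStokes.CubeKernelStepNegative

end
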